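import Literature.RingTheory.FormalGroups.CocyclePolynomial
import Mathlib.NumberTheory.Basic
import Mathlib.RingTheory.MvPolynomial.Basic
import Mathlib.Algebra.CharP.Lemmas
import Mathlib.Tactic.LinearCombination
import Mathlib.Tactic.Ring
import HarnessLib

/-!
# The Frobenius congruence `C_{p^k}(X,Y) ≡ C_p(X^{p^{k−1}}, Y^{p^{k−1}}) (mod p)` for Lazard's polynomials
# ([Hazewinkel 1978] §5.2; used in [Drinfeld 1974] §1)

Topic `Literature/RingTheory/FormalGroups`; namespace `Literature.RingTheory.FormalGroups`.  One definition (the evaluated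
Lazard polynomial `cocyclePolyEval`) + fully proved theorems; no named fact, no instance, no notation, no `sorry`.  Cell
`hodgecm-mathlib`, P6 «MOD programme», sub-line P6d; input of Drinfeld's key lemma (sibling `DrinfeldCocycle`): over a finite
field of characteristic `p` the function `(x,y) ↦ C_{p^k}(x,y)` is not identically zero, because modulo `p` the polynomial
`C_{p^k}` is `C_p` composed with the `(k−1)`-st power of Frobenius and `C_p(1,T)` has degree `p − 1`.

* `cocyclePolyEval S n x y = Σ_{j ≤ n} cocycleCoeff n j · x^j · y^{n−j}` — the value `C_n(x,y)` in any commutative (semi)ring;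
  `map_cocyclePolyEval` (ring homomorphisms commute with it).
* `lazardNu_mul_cocyclePolyEval` — `ν(n) · C_n(x,y) = (x+y)^n − x^n − y^n` (`n ≥ 1`).
* `cocyclePolyEval_prime_pow_eq_of_charP` — in characteristic `p`:
  `C_{p^k}(x,y) = C_p(x^{p^{k−1}}, y^{p^{k−1}})` (`k ≥ 1`), from the integral congruence
  `(X+Y)^{p^k} ≡ (X^{p^{k−1}} + Y^{p^{k−1}})^p (mod p²)` (Mathlib `dvd_sub_pow_of_dvd_sub`) and cancellation of `p` in `ℤ[X,Y]`.

Deliberately NOT here: the cocycle lemma (siblings `SymmetricCocycleField`, `SymmetricCocycleLemma`).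
-/

namespace Literature.RingTheory.FormalGroups

open Finset

/-! ## §1 The evaluated Lazard polynomial -/

/-- **`C_n(x,y)`**: the value `Σ_{j ≤ n} cocycleCoeff n j · x^j · y^{n−j}` of Lazard's polynomial `C_n = ((X+Y)^n−X^n−Y^n)/ν(n)`
at elements `x, y` of a commutative semiring. [cite: Lazard1955, §II Lemme 3] -/
def cocyclePolyEval (S : Type*) [CommSemiring S] (n : ℕ) (x y : S) : S :=
  ∑ j ∈ range (n + 1), (cocycleCoeff n j : S) * x ^ j * y ^ (n - j)

/-- Ring homomorphisms commute with `C_n(x,y)`. [cite: Lazard1955, §II Lemme 3] -/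
theorem map_cocyclePolyEval {S T : Type*} [CommSemiring S] [CommSemiring T] (f : S →+* T) (n : ℕ) (x y : S) :
    f (cocyclePolyEval S n x y) = cocyclePolyEval T n (f x) (f y) := by
  simp [cocyclePolyEval, map_sum, map_mul, map_pow, map_natCast]

/-- **`ν(n)·C_n(x,y) = (x+y)^n − x^n − y^n`** (`n ≥ 1`), i.e. `(x+y)^n = x^n + y^n + ν(n)·C_n(x,y)`, in any commutative semiring.
[cite: Lazard1955, §II Lemme 3] -/
theorem add_pow_eq_add_lazardNu_mul_cocyclePolyEval {S : Type*} [CommSemiring S] {n : ℕ} (hn : 0 < n) (x y : S) :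
    (x + y) ^ n = x ^ n + y ^ n + (lazardNu n : S) * cocyclePolyEval S n x y := by
  obtain ⟨n, rfl⟩ := Nat.exists_eq_add_of_le' hn
  rw [cocyclePolyEval, Finset.mul_sum, add_pow, Finset.sum_range_succ, Finset.sum_range_succ', Finset.sum_range_succ,
    Finset.sum_range_succ']
  simp only [cocycleCoeff_zero_right, Nat.cast_zero, zero_mul, mul_zero, add_zero, Nat.choose_zero_right, Nat.cast_one,
    mul_one, pow_zero, one_mul, Nat.sub_zero, Nat.choose_self, Nat.sub_self,
    cocycleCoeff_eq_zero_of_le (le_refl (n + 1))]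
  have hmid : ∀ j ∈ range n, (lazardNu (n + 1) : S) * ((cocycleCoeff (n + 1) (j + 1) : S) * x ^ (j + 1) * y ^ (n + 1 - (j + 1)))
      = x ^ (j + 1) * y ^ (n + 1 - (j + 1)) * ((n + 1).choose (j + 1) : S) := by
    intro j hj
    rw [← mul_assoc, ← mul_assoc, ← Nat.cast_mul, lazardNu_mul_cocycleCoeff (Nat.succ_pos j)
      (by simpa using Finset.mem_range.1 hj)]
    ring
  rw [Finset.sum_congr rfl hmid]
  ring

/-! ## §2 The congruence modulo `p` -/

section Frobenius

variable {p : ℕ} [hp : Fact p.Prime]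

/-- `(x+y)^{p^j} − x^{p^j} − y^{p^j}` is a multiple of `p` (any `j ≥ 0`). [cite: Hazewinkel1978, §5.2] -/
private theorem dvd_add_pow_prime_pow_sub {S : Type*} [CommRing S] (j : ℕ) (x y : S) :
    (p : S) ∣ (x + y) ^ p ^ j - (x ^ p ^ j + y ^ p ^ j) := by
  rcases Nat.eq_zero_or_pos j with rfl | hj
  · simp
  · refine ⟨cocyclePolyEval S (p ^ j) x y, ?_⟩
    rw [add_pow_eq_add_lazardNu_mul_cocyclePolyEval (pow_pos hp.out.pos j), lazardNu_prime_pow hp.out hj]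
    ring

/-- **Integral form**: in a commutative ring in which `p` is not a zero divisor,
`C_{p^k}(x,y) − C_p(x^{p^{k−1}}, y^{p^{k−1}})` is a multiple of `p` (`k ≥ 1`). [cite: Hazewinkel1978, §5.2] -/
theorem dvd_cocyclePolyEval_prime_pow_sub {S : Type*} [CommRing S] (hreg : IsRegular (p : S)) {k : ℕ} (hk : 0 < k)
    (x y : S) : (p : S) ∣ cocyclePolyEval S (p ^ k) x y - cocyclePolyEval S p (x ^ p ^ (k - 1)) (y ^ p ^ (k - 1)) := by
  obtain ⟨k, rfl⟩ := Nat.exists_eq_add_of_le' hk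
  rw [Nat.add_sub_cancel]
  -- `p² ∣ (x+y)^{p^{k+1}} − (x^{p^k}+y^{p^k})^p`
  have h2 : (p : S) ^ (1 + 1) ∣ ((x + y) ^ p ^ k) ^ p ^ 1 - (x ^ p ^ k + y ^ p ^ k) ^ p ^ 1 :=
    dvd_sub_pow_of_dvd_sub (dvd_add_pow_prime_pow_sub k x y) 1
  rw [pow_one, ← pow_mul, ← pow_succ] at h2
  obtain ⟨E, hE⟩ := h2
  -- `p·C_{p^{k+1}}(x,y) = (x+y)^{p^{k+1}} − x^{p^{k+1}} − y^{p^{k+1}}`, `p·C_p(u,v) = (u+v)^p − u^p − v^p`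
  have hA := add_pow_eq_add_lazardNu_mul_cocyclePolyEval (pow_pos hp.out.pos (k + 1)) x y
  have hB := add_pow_eq_add_lazardNu_mul_cocyclePolyEval hp.out.pos (x ^ p ^ k) (y ^ p ^ k)
  rw [lazardNu_prime_pow hp.out (Nat.succ_pos k)] at hA
  rw [lazardNu_prime hp.out, ← pow_mul, ← pow_mul, ← pow_succ] at hB
  refine ⟨E, hreg.left ?_⟩
  dsimp only
  have : (p : S) * (cocyclePolyEval S (p ^ (k + 1)) x y - cocyclePolyEval S p (x ^ p ^ k) (y ^ p ^ k))
      = (x + y) ^ p ^ (k + 1) - (x ^ p ^ k + y ^ p ^ k) ^ p := by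
    linear_combination -hA + hB
  rw [this, hE]
  ring

/-- **The Frobenius congruence, characteristic-`p` form**: in a commutative ring of characteristic `p`,
`C_{p^k}(x,y) = C_p(x^{p^{k−1}}, y^{p^{k−1}})` for `k ≥ 1` — `C_{p^k} ≡ C_p ∘ Frob^{k−1} (mod p)`.
[cite: Hazewinkel1978, §5.2] -/
theorem cocyclePolyEval_prime_pow_eq_of_charP (R : Type*) [CommRing R] [CharP R p] {k : ℕ} (hk : 0 < k) (x y : R) :
    cocyclePolyEval R (p ^ k) x y = cocyclePolyEval R p (x ^ p ^ (k - 1)) (y ^ p ^ (k - 1)) := by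
  -- the universal case `ℤ[X,Y]`
  let P := MvPolynomial (Fin 2) ℤ
  have hreg : IsRegular (p : P) := by
    refine IsRegular.of_ne_zero ?_
    exact_mod_cast hp.out.ne_zero
  obtain ⟨E, hE⟩ := dvd_cocyclePolyEval_prime_pow_sub (S := P) hreg hk (MvPolynomial.X 0) (MvPolynomial.X 1)
  let φ : P →+* R := MvPolynomial.eval₂Hom (Int.castRingHom R) ![x, y]
  have hφ := congrArg φ hE
  rw [map_sub, map_cocyclePolyEval, map_cocyclePolyEval, map_pow, map_pow, map_mul, map_natCast, CharP.cast_eq_zero,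
    zero_mul, sub_eq_zero] at hφ
  have h0 : φ (MvPolynomial.X 0) = x := MvPolynomial.eval₂Hom_X' _ _ 0
  have h1 : φ (MvPolynomial.X 1) = y := MvPolynomial.eval₂Hom_X' _ _ 1
  rwa [h0, h1] at hφ

end Frobenius

/-! ## §3 `C_p(1, T)` has degree `p − 1` with leading coefficient… first coefficient `1` -/

/-- `C_n(x, y)` with `y = 0`: only the (vanishing) `j = n` term survives, so `C_n(x,0) = 0`. [cite: Lazard1955, §II Lemme 3] -/
theorem cocyclePolyEval_zero_right {S : Type*} [CommSemiring S] (n : ℕ) (x : S) : cocyclePolyEval S n x 0 = 0 := by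
  refine Finset.sum_eq_zero fun j _ => ?_
  rcases Nat.lt_or_ge j n with h | h
  · rw [zero_pow (by omega), mul_zero]
  · rw [cocycleCoeff_eq_zero_of_le h, Nat.cast_zero, zero_mul, zero_mul]

/-- Every monomial of `C_n(x,y)` is divisible by `y`: `y ∣ C_n(x,y)`. [cite: Lazard1955, §II Lemme 3] -/
theorem dvd_cocyclePolyEval_right {S : Type*} [CommSemiring S] (n : ℕ) (x y : S) : y ∣ cocyclePolyEval S n x y := by
  refine Finset.dvd_sum fun j _ => ?_
  rcases Nat.lt_or_ge j n with h | h
  · exact Dvd.dvd.mul_left (dvd_pow_self y (by omega)) _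
  · simp [cocycleCoeff_eq_zero_of_le h]

end Literature.RingTheory.FormalGroups
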